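import Mathlib
import Literature.NumberTheory.ComplexMultiplication.EmbeddingActionFaithful
import HarnessLib

/-!
# Dodson's imprimitivity bound: `|Gal(Kᶜ/ℚ)|` divides `2ⁿ · n!` for a CM field `K` of degree `2n`

[Dodson1984, §1.1 Imprimitivity Theorem, p. 3]: for a CM field `K` of degree `2n` with Galois closure `Kᶜ`,
the group `G = Gal(Kᶜ/ℚ)` "may be represented as an imprimitive permutation group of degree `2n` with `n`
sets of imprimitivity of order `2`", the sets of imprimitivity being the complex-conjugate pairs of
embeddings, so that `G ≤ Im(n, 2) = (ℤ/2)ⁿ ⋊ 𝔖ₙ` (loc. cit. (3)); in particular `|G|` divides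
`|Im(n, 2)| = 2ⁿ · n!` (the hyperoctahedral group `W(Bₙ)`).

This file proves the ORDER BOUND in every degree, in three layers:

* permutations — a fixed-point-free involution `c` of a finite set of size `2k` has cycle type `(2, …, 2)`
  (`cycleType_of_involutive_fixedPointFree`) and its centraliser in the symmetric group — the group
  `Im(k, 2)` of permutations preserving the `k` pairs `{x, c x}` — has order `2ᵏ · k!`
  (`nat_card_centralizer_of_involutive_fixedPointFree`, from Mathlib's `Equiv.Perm.nat_card_centralizer`);
* abstract actions — a group acting faithfully on a finite set `X` with a CENTRAL fixed-point-free
  involution `c` embeds in that centraliser, so `|G| ∣ 2^(|X|/2) · (|X|/2)!`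
  (`card_dvd_two_pow_mul_factorial_of_central_involution`);
* number fields — for a normal closure `L` of a number field `K` over `ℚ` and a central involution
  `c ∈ Gal(L/ℚ)` moving every embedding `K → L`: `|Gal(L/ℚ)| ∣ 2^([K:ℚ]/2) · ([K:ℚ]/2)!`
  (`card_aut_dvd_two_pow_mul_factorial`); the CM form with `c = conjGal` for `L` CM and `K` totally complex
  (`card_aut_dvd_two_pow_mul_factorial_cm`, `finrank_dvd_two_pow_mul_factorial_cm`), and the two degrees
  used in Dodson's tables: `[L:ℚ] ∣ 48` for sextic `K` and `[L:ℚ] ∣ 384` for octic `K`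
  (`finrank_dvd_48_of_sextic_cm`, `finrank_dvd_384_of_octic_cm`; [Dodson1984, §5.1.2 Theorem] lists the sextic
  closures `ℤ₂ × ℤ₃, ℤ₂ × 𝔖₃, (ℤ₂)³ ⋊ ℤ₃, (ℤ₂)³ ⋊ 𝔖₃` of order `6, 12, 24, 48`, all divisors of `48`).

The faithful action `Gal(L/ℚ) ↷ Hom_ℚ(K, L)`, `|Hom_ℚ(K, L)| = [K:ℚ]` and the central involution `conjGal`
with `conjGal • φ ≠ φ` are the tree's `EmbeddingAction` / `EmbeddingActionFaithful`. The sextic case with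
its explicit `W(B₃) ≤ 𝔖₆` coordinates is `range_toPerm6_le_W` (file `SexticCMTypesB3Abstract`) and
`card_W = 48` (file `SexticCMTypesB3`); this file
is the coordinate-free statement in general degree (no transitivity or block-system language is needed for
the order bound: centrality of `c` alone puts `G` inside the centraliser).

## References

* [Dodson1984] B. Dodson, *The structure of Galois groups of CM-fields*, Trans. Amer. Math. Soc. 283 (1984)
  1–32, doi:10.2307/1999987 — §1.1 Imprimitivity Theorem (p. 3), §5.1.2 Theorem (p. 20, sextic closures).

## Provenance

Pub-hodgecm formalisation cell (EXPANSION part (b) `PohlmannSpan` lineage, generation 15), LEAN-IN-TREE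
extraction: the Literature content of the cell's package file `HodgeCM/Proofs/Pohlmann/GaloisSpanHyperoctahedral.lean`
(generation 13: `card_barPerms`, `card_aut_dvd_two_pow_mul_factorial`, `finrank_galoisClosure_dvd_two_pow_mul_factorial`,
`finrank_galoisClosure_dvd_48`, `finrank_galoisClosure_dvd_384`, stated there for `Hom(F, ℂ)` and Mathlib's
`IsCMField.galoisClosure`), re-proved here from scratch over the tree's abstract normal-closure setting
`IsNormalClosure ℚ K L` via the centraliser order instead of an explicit coding of pair-preserving
permutations. Nothing of the cell's manuscript is cited.

## Not here

Transitivity / the block system itself, the semidirect-product structure `(ℤ/2)^v ⋊ G₀` of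
[Dodson1984, §1.1 (1)–(3)], reflex degrees, CM types.
-/

set_option autoImplicit false

namespace Literature.NumberTheory.ComplexMultiplication

open Equiv (Perm)

/-! ### Permutations: the centraliser of a fixed-point-free involution has order `2ᵏ · k!` -/

section Perm

variable {α : Type*} [DecidableEq α] [Fintype α]

/-- A fixed-point-free involution of a finite set has full support. [folklore] -/
theorem support_eq_univ_of_fixedPointFree (c : Perm α) (hfix : ∀ x, c x ≠ x) : c.support = Finset.univ :=
  Finset.eq_univ_iff_forall.mpr fun x => Equiv.Perm.mem_support.mpr (hfix x)

/-- **Cycle type of a fixed-point-free involution**: `(2, 2, …, 2)` with `|α| / 2` entries (it has prime order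
`2`, so all cycles are transpositions, and they cover `α`). [folklore] -/
theorem cycleType_of_involutive_fixedPointFree (c : Perm α) (hc2 : c * c = 1) (hfix : ∀ x, c x ≠ x) :
    c.cycleType = Multiset.replicate (Fintype.card α / 2) 2 := by
  by_cases h1 : c = 1
  · have hα : Fintype.card α = 0 :=
      Fintype.card_eq_zero_iff.mpr ⟨fun x => hfix x (by rw [h1, Equiv.Perm.coe_one, id])⟩
    rw [h1, Equiv.Perm.cycleType_one, hα, Nat.zero_div, Multiset.replicate_zero]
  · haveI : Fact (Nat.Prime 2) := ⟨Nat.prime_two⟩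
    have hord : orderOf c = 2 := orderOf_eq_prime (by rw [pow_two]; exact hc2) h1
    obtain ⟨n, hn⟩ := Equiv.Perm.cycleType_prime_order (σ := c) (by rw [hord]; exact Nat.prime_two)
    rw [hord] at hn
    have hsum := Equiv.Perm.sum_cycleType c
    rw [hn, Multiset.sum_replicate, smul_eq_mul, support_eq_univ_of_fixedPointFree c hfix,
      Finset.card_univ] at hsum
    rw [hn, ← hsum, Nat.mul_div_cancel _ Nat.two_pos]

/-- A finite set carrying a fixed-point-free involution has even size: `|α| / 2 * 2 = |α|`. [folklore] -/
theorem card_div_two_mul_two_of_involutive_fixedPointFree (c : Perm α) (hc2 : c * c = 1)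
    (hfix : ∀ x, c x ≠ x) : Fintype.card α / 2 * 2 = Fintype.card α := by
  have hsum := Equiv.Perm.sum_cycleType c
  rwa [cycleType_of_involutive_fixedPointFree c hc2 hfix, Multiset.sum_replicate, smul_eq_mul,
    support_eq_univ_of_fixedPointFree c hfix, Finset.card_univ] at hsum

/-- **`|Im(k, 2)| = 2ᵏ · k!`**: the centraliser in `𝔖(α)` of a fixed-point-free involution `c` (the
permutations preserving the `k = |α|/2` pairs `{x, c x}` — Dodson's `Im(k, 2) = (ℤ/2)ᵏ ⋊ 𝔖ₖ`, the
hyperoctahedral group) has order `2ᵏ · k!`. [cite: Dodson1984, §1.1 Imprimitivity Theorem] -/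
theorem nat_card_centralizer_of_involutive_fixedPointFree (c : Perm α) (hc2 : c * c = 1)
    (hfix : ∀ x, c x ≠ x) :
    Nat.card (Subgroup.centralizer ({c} : Set (Perm α))) =
      2 ^ (Fintype.card α / 2) * (Fintype.card α / 2).factorial := by
  have hct := cycleType_of_involutive_fixedPointFree c hc2 hfix
  have heven := card_div_two_mul_two_of_involutive_fixedPointFree c hc2 hfix
  rw [Equiv.Perm.nat_card_centralizer, hct, Multiset.sum_replicate, smul_eq_mul, heven, Nat.sub_self,
    Nat.factorial_zero, one_mul, Multiset.prod_replicate]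
  congr 1
  rcases Nat.eq_zero_or_pos (Fintype.card α / 2) with hk | hk
  · rw [hk]
    simp
  · have htf : (Multiset.replicate (Fintype.card α / 2) 2).toFinset = {2} := by
      ext n
      simp [hk.ne']
    rw [htf, Finset.prod_singleton, Multiset.count_replicate_self]

end Perm

/-! ### Faithful actions with a central fixed-point-free involution -/

section Action

variable {G : Type*} [Group G] {X : Type*} [Fintype X] [DecidableEq X] [MulAction G X] [FaithfulSMul G X]

/-- **Order bound from a central fixed-point-free involution.** If `G` acts faithfully on a finite set `X` and
`c ∈ Z(G)` is an involution moving every point, then `G ↪ C_{𝔖(X)}(c) ≅ Im(|X|/2, 2)`, so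
`|G| ∣ 2^(|X|/2) · (|X|/2)!`. [cite: Dodson1984, §1.1 Imprimitivity Theorem] -/
theorem card_dvd_two_pow_mul_factorial_of_central_involution {c : G} (hcen : ∀ g : G, c * g = g * c)
    (hc2 : c * c = 1) (hfix : ∀ x : X, c • x ≠ x) :
    Nat.card G ∣ 2 ^ (Fintype.card X / 2) * (Fintype.card X / 2).factorial := by
  let f : G →* Perm X := MulAction.toPermHom G X
  have hf : Function.Injective f := MulAction.toPerm_injective
  have hfc : ∀ x, f c x = c • x := fun _ => rfl
  have hmem : ∀ g : G, f g ∈ Subgroup.centralizer ({f c} : Set (Perm X)) := fun g => by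
    rw [Subgroup.mem_centralizer_singleton_iff, ← map_mul, ← map_mul, hcen g]
  have key := Subgroup.card_dvd_of_injective (f.codRestrict _ hmem)
    (fun a b hab => hf (congrArg Subtype.val hab))
  rwa [nat_card_centralizer_of_involutive_fixedPointFree (f c) (by rw [← map_mul, hc2, map_one])
    (fun x => by rw [hfc]; exact hfix x)] at key

end Action

/-! ### Number fields: `|Gal(L/ℚ)| ∣ 2ⁿ · n!` -/

section Field

open NumberField

variable {L : Type*} [Field L] [NumberField L] (K : Type*) [Field K] [NumberField K]

/-- **Imprimitivity bound, abstract-`c` form.** `L` a normal closure of the number field `K` over `ℚ`,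
`c ∈ Gal(L/ℚ)` a central involution moving every embedding `K → L` (e.g. complex conjugation of a CM closure
of a totally complex `K`): `|Gal(L/ℚ)|` divides `2^([K:ℚ]/2) · ([K:ℚ]/2)!` — `Gal(L/ℚ)` acts faithfully on
the `[K:ℚ]` embeddings (`faithfulSMul_algEquiv_algHom`, `card_algHom_eq_finrank`).
[cite: Dodson1984, §1.1 Imprimitivity Theorem] -/
theorem card_aut_dvd_two_pow_mul_factorial [IsNormalClosure ℚ K L] (c : L ≃ₐ[ℚ] L)
    (hcen : ∀ g : L ≃ₐ[ℚ] L, c * g = g * c) (hc2 : c * c = 1) (hfix : ∀ φ : K →ₐ[ℚ] L, c • φ ≠ φ) :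
    Nat.card (L ≃ₐ[ℚ] L) ∣ 2 ^ (Module.finrank ℚ K / 2) * (Module.finrank ℚ K / 2).factorial := by
  classical
  have h := card_dvd_two_pow_mul_factorial_of_central_involution (X := K →ₐ[ℚ] L) hcen hc2 hfix
  rwa [card_algHom_eq_finrank K] at h

/-- With such a `c`, `[K:ℚ]` is even: `[K:ℚ] / 2 * 2 = [K:ℚ]`. [folklore] -/
theorem finrank_div_two_mul_two [IsNormalClosure ℚ K L] (c : L ≃ₐ[ℚ] L) (hc2 : c * c = 1)
    (hfix : ∀ φ : K →ₐ[ℚ] L, c • φ ≠ φ) :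
    Module.finrank ℚ K / 2 * 2 = Module.finrank ℚ K := by
  classical
  have h := card_div_two_mul_two_of_involutive_fixedPointFree (MulAction.toPermHom (L ≃ₐ[ℚ] L) _ c)
    (by rw [← map_mul, hc2, map_one]) (fun φ : K →ₐ[ℚ] L => hfix φ)
  rwa [card_algHom_eq_finrank K] at h

variable [IsCMField L] [IsTotallyComplex K]

/-- **Dodson's imprimitivity bound** [Dodson1984, §1.1, p. 3]: for a CM field `L` that is a normal closure of
the totally complex number field `K` of degree `2n` over `ℚ` (e.g. `K` a CM field and `L` its Galois closure),
`|Gal(L/ℚ)| ∣ 2ⁿ · n!` — the case `c = conjGal` (central: `conjGal_central`; an involution: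
`conjGal_mul_conjGal`; moves every embedding: `conjGal_smul_ne`). [cite: Dodson1984, §1.1 Imprimitivity Theorem] -/
theorem card_aut_dvd_two_pow_mul_factorial_cm [IsNormalClosure ℚ K L] :
    Nat.card (L ≃ₐ[ℚ] L) ∣ 2 ^ (Module.finrank ℚ K / 2) * (Module.finrank ℚ K / 2).factorial :=
  card_aut_dvd_two_pow_mul_factorial K conjGal conjGal_central conjGal_mul_conjGal conjGal_smul_ne

/-- **Dodson's imprimitivity bound, degree form**: `[L:ℚ] ∣ 2ⁿ · n!` with `2n = [K:ℚ]`, for `L` a CM normal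
closure of the totally complex number field `K` over `ℚ`. [cite: Dodson1984, §1.1 Imprimitivity Theorem] -/
theorem finrank_dvd_two_pow_mul_factorial_cm [IsNormalClosure ℚ K L] :
    Module.finrank ℚ L ∣ 2 ^ (Module.finrank ℚ K / 2) * (Module.finrank ℚ K / 2).factorial := by
  haveI := isGalois_of_isNormalClosure (L := L) K
  rw [← IsGalois.card_aut_eq_finrank ℚ L]
  exact card_aut_dvd_two_pow_mul_factorial_cm K

/-- Sextic case: the Galois closure of a sextic CM field has degree dividing `48 = 2³ · 3!` (Dodson's sextic
closures have order `6, 12, 24` or `48`, loc. cit. §5.1.2 Theorem). [cite: Dodson1984, §1.1 Imprimitivity Theorem] -/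
theorem finrank_dvd_48_of_sextic_cm [IsNormalClosure ℚ K L] (hK : Module.finrank ℚ K = 6) :
    Module.finrank ℚ L ∣ 48 := by
  have h := finrank_dvd_two_pow_mul_factorial_cm (L := L) K
  rw [hK] at h
  exact h

/-- Octic case: the Galois closure of an octic CM field has degree dividing `384 = 2⁴ · 4!`.
[cite: Dodson1984, §1.1 Imprimitivity Theorem] -/
theorem finrank_dvd_384_of_octic_cm [IsNormalClosure ℚ K L] (hK : Module.finrank ℚ K = 8) :
    Module.finrank ℚ L ∣ 384 := by
  have h := finrank_dvd_two_pow_mul_factorial_cm (L := L) K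
  rw [hK] at h
  exact h

end Field

end Literature.NumberTheory.ComplexMultiplication
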